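import Mathlib
import Literature.NumberTheory.Transcendental.KZCalculus
import Literature.NumberTheory.Transcendental.SemialgebraicMapsProofs
import Literature.NumberTheory.Transcendental.SemialgebraicMonotonicityProofs
import Literature.NumberTheory.Transcendental.SemialgebraicAlgebraicPoints
import Literature.NumberTheory.Transcendental.EllIterRepShuffle
import Literature.NumberTheory.Transcendental.KZLogCalculusProofs
import Summits.KontsevichZagierPeriods.KontsevichZagierPeriods.Theorems.HyperbolicBlochOffTetraSectorKernelRungZeroLogRelations
import Summits.KontsevichZagierPeriods.KontsevichZagierPeriods.Theorems.HermiteRigidityGenusTwoCycleTransferPushforwardDimOne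
import HarnessLib

/-!
# Stub `stub_dlogUnfold` — crux `TorsionLogs.NeronTorsionSector`, line `registered` (block S6), I:
# breakpoints and the one-cell moves

Auxiliary file for `TorsionLogsNeronTorsionSectorStubDlogUnfold.lean`, which unfolds a
one-dimensional Kontsevich–Zagier representation `[(a, b), G′/G dx]` (`G > 0` continuous and
`ℚ`-semialgebraic on `[a, b]`, with a `ℚ`-semialgebraic derivative `G′` on `(a, b)`) into a
`ℤ`-combination of interval log carriers `[(α, β), dt/t]`. Here:

* `exists_dlog_breakpoints` — **o-minimality**: there is a finite set `S` of REAL-ALGEBRAIC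
  breakpoints such that on every open subinterval of `(a, b)` avoiding `S` the derivative `G′`
  either vanishes identically or vanishes nowhere. (`Z = {G′ = 0}` is `ℚ`-semialgebraic; by
  van den Dries Ch. 1 (3.3) membership in `Z` is locally constant off finitely many points; the
  points where it is not are algebraic by genericity of transcendental points,
  `isAlgebraic_of_not_mem_nhds`; conclude by connectedness of intervals.)
* `of_sub_of_mem_relations_of_cov_fin_one` — rule (2) of the calculus for the coordinate map
  `Φ(p) = (G (p 0))` of `ℝ¹` (Jacobian `G′ • id`, determinant `G′`).
* `dlog_cell_const`, `dlog_cell_cov` — the two kinds of cells: where `G′ ≡ 0` the function `G`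
  is constant (mean value theorem); where `G′ ≠ 0` it has one sign (Darboux), `G` is strictly
  monotone and `t = G(x)` carries `[(u, v), G′/G]` to `±[(G u, G v)^{±}, dt/t]`, of value
  `log (G v / G u)`.

References: L. van den Dries, *Tame Topology and O-minimal Structures* (1998), Ch. 1 (3.2)–(3.3),
Ch. 3 (1.2); M. Kontsevich, D. Zagier, *Periods* (2001), §1.2 rules (1), (2); J. Bochnak,
M. Coste, M.-F. Roy, *Real Algebraic Geometry* (1998), §2.1–2.2.
-/

noncomputable section

-- `Summit.KontsevichZagierPeriods.KontsevichZagierPeriods.…` is the tree's mandated layout (single-conjunct summit).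
set_option linter.dupNamespace false

open Set MeasureTheory Filter Topology
open Literature.NumberTheory.Transcendental Literature.ModelTheory.ExponentialFields
open Summit.KontsevichZagierPeriods.HyperbolicBloch.OffTetraSectorKernel (exists_logRep
  isSemialgebraic_logIvl)
open Summit.KontsevichZagierPeriods.HermiteRigidity.GenusTwoCycleTransfer (hasFDerivAt_fin_one
  det_smul_id_fin_one)

namespace Summit.KontsevichZagierPeriods.KontsevichZagierPeriods.Cruxes.NeronTorsionSector.Translation

/-! ### Breakpoints: o-minimality of the zero set of `G′` -/

/-- **Algebraic breakpoints of a `ℚ`-semialgebraic function of one variable.** If `G′` is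
`ℚ`-semialgebraic on `(a, b)`, there is a finite set `S` of real-algebraic numbers such that on
every open subinterval `(u, v) ⊆ (a, b)` containing no point of `S`, either `G′ ≡ 0` or `G′`
vanishes nowhere. The zero set `Z = {x ∈ (a, b) | G′ x = 0}` is `ℚ`-semialgebraic (graph
elimination); membership in `Z` is locally constant off a finite set (van den Dries Ch. 1 (3.3));
the points where it is not locally constant are algebraic (a transcendental point is generic for
`ℚ`-semialgebraic subsets of the line); and on a connected interval of locally constant membership
`Z` is everything or nothing. [cite: Dries1998, Ch. 1 (3.3)(ii) and Ch. 2 (3.3)] -/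
theorem exists_dlog_breakpoints {a b : ℝ} {G' : ℝ → ℝ}
    (hG' : IsSemialgebraicFunOn ℚ {t : Fin 1 → ℝ | t 0 ∈ Ioo a b} (fun t => G' (t 0))) :
    ∃ S : Finset ℝ, (∀ x ∈ S, IsAlgebraic ℚ x) ∧
      ∀ u v : ℝ, Ioo u v ⊆ Ioo a b → (∀ x ∈ S, x ∉ Ioo u v) →
        (∀ x ∈ Ioo u v, G' x = 0) ∨ (∀ x ∈ Ioo u v, G' x ≠ 0) := by
  classical
  -- the zero set `Z` of `G′` and its `ℚ`-semialgebraic avatar in `ℝ¹`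
  set Z : Set ℝ := {x | x ∈ Ioo a b ∧ G' x = 0} with hZ
  have hZ₁ : IsSemialgebraic ℚ {t : Fin 1 → ℝ | t 0 ∈ Z} := by
    have hT : IsSemialgebraic ℚ {z : Fin (1 + 1) → ℝ | z (Fin.last 1) = 0} := by
      simpa using isSemialgebraic_setOf_eval_eq_zero (k := ℚ) (R := ℝ)
        (MvPolynomial.X (Fin.last 1) : MvPolynomial (Fin (1 + 1)) ℚ)
    convert hG'.isSemialgebraic_sep_snoc_mem tarski_seidenberg_real_holds hT using 1
    ext t
    simp only [mem_setOf_eq, Fin.snoc_last, hZ]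
  -- o-minimality: off finitely many points, membership in `Z` is locally constant
  obtain ⟨F, hF⟩ := SemialgebraicMonotonicity.exists_finset_Ioo_subset_or_disjoint
    (SemialgebraicMonotonicity.isSemialgebraic_real_of hZ₁)
  set S : Set ℝ := {x | Z ∉ 𝓝 x ∧ Zᶜ ∉ 𝓝 x} with hS
  have hSF : S ⊆ ↑F := by
    intro x hx
    by_contra hxF
    obtain ⟨p, q, hpx, hxq, hpq⟩ := exists_Ioo_forall_notMem_of_notMem F hxF
    have hI : Ioo p q ∈ 𝓝 x := Ioo_mem_nhds hpx hxq
    rcases hF p q hpq with h | h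
    · exact hx.1 (mem_of_superset hI h)
    · exact hx.2 (mem_of_superset hI fun y hy => Set.disjoint_left.1 h hy)
  have hSfin : S.Finite := F.finite_toSet.subset hSF
  have hc : Continuous fun y : ℝ => (fun _ : Fin 1 => y) := continuous_pi fun _ => continuous_id
  refine ⟨hSfin.toFinset, fun x hx => ?_, fun u v huv hSuv => ?_⟩
  · -- the non-locally-constant points are algebraic
    rw [Set.Finite.mem_toFinset] at hx
    have key := isAlgebraic_of_not_mem_nhds (x := fun _ : Fin 1 => x) hZ₁
      (fun h => hx.1 (hc.continuousAt.preimage_mem_nhds h))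
      (fun h => hx.2 (hc.continuousAt.preimage_mem_nhds h))
    simpa using key
  · -- dichotomy on an interval avoiding `S`, by connectedness
    have hloc : ∀ x ∈ Ioo u v, ∀ᶠ y in 𝓝 x, y ∈ Z ↔ x ∈ Z := by
      intro x hx
      have hxS : x ∉ S := fun h => hSuv x (hSfin.mem_toFinset.2 h) hx
      simp only [hS, mem_setOf_eq, not_and_or, not_not] at hxS
      rcases hxS with h | h
      · have hxZ : x ∈ Z := mem_of_mem_nhds h
        filter_upwards [h] with y hy
        exact iff_of_true hy hxZ
      · have hxZ : x ∈ Zᶜ := mem_of_mem_nhds h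
        filter_upwards [h] with y hy
        exact iff_of_false hy hxZ
    rcases FibreLength.subset_or_disjoint_of_isPreconnected isPreconnected_Ioo hloc with h | h
    · exact Or.inl fun x hx => (h hx).2
    · exact Or.inr fun x hx hx0 => Set.disjoint_left.1 h hx ⟨huv hx, hx0⟩

/-! ### Rule (2) along a function of one variable -/

/-- The image of a slab `{p | p 0 ∈ I} ⊆ ℝ¹` under the coordinate map `p ↦ (G (p 0))` is the slab
over `G '' I`. [folklore] -/
theorem image_slab_eq {G : ℝ → ℝ} {I J : Set ℝ} (h : G '' I = J) :
    (fun p : Fin 1 → ℝ => fun _ : Fin 1 => G (p 0)) '' {p | p 0 ∈ I} = {p | p 0 ∈ J} := by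
  ext q
  simp only [mem_setOf_eq, mem_image]
  constructor
  · rintro ⟨p, hp, rfl⟩
    rw [← h]
    exact mem_image_of_mem G hp
  · intro hq
    rw [← h] at hq
    obtain ⟨x, hx, hxq⟩ := hq
    refine ⟨fun _ => x, hx, ?_⟩
    funext i
    rw [Fin.fin_one_eq_zero i, ← hxq]

/-- A continuous strictly increasing function maps `(u, v)` onto `(G u, G v)`. [folklore] -/
theorem image_Ioo_of_strictMonoOn {G : ℝ → ℝ} {u v : ℝ} (huv : u ≤ v)
    (hc : ContinuousOn G (Icc u v)) (hm : StrictMonoOn G (Icc u v)) :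
    G '' Ioo u v = Ioo (G u) (G v) := by
  refine Subset.antisymm ?_ (intermediate_value_Ioo huv hc)
  rintro _ ⟨x, hx, rfl⟩
  exact ⟨hm (left_mem_Icc.2 huv) (Ioo_subset_Icc_self hx) hx.1,
    hm (Ioo_subset_Icc_self hx) (right_mem_Icc.2 huv) hx.2⟩

/-- A continuous strictly decreasing function maps `(u, v)` onto `(G v, G u)`. [folklore] -/
theorem image_Ioo_of_strictAntiOn {G : ℝ → ℝ} {u v : ℝ} (huv : u ≤ v)
    (hc : ContinuousOn G (Icc u v)) (hm : StrictAntiOn G (Icc u v)) :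
    G '' Ioo u v = Ioo (G v) (G u) := by
  refine Subset.antisymm ?_ (intermediate_value_Ioo' huv hc)
  rintro _ ⟨x, hx, rfl⟩
  exact ⟨hm (Ioo_subset_Icc_self hx) (right_mem_Icc.2 huv) hx.2,
    hm (left_mem_Icc.2 huv) (Ioo_subset_Icc_self hx) hx.1⟩

/-- **Rule (2) along a function of one variable.** If `r₀ = [{p 0 ∈ I}, f]`, `G` is
`ℚ`-semialgebraic on the domain, injective on `I` with derivative `G′` there, and `c′` is a
representation on the slab over `G '' I` with `f p = c′.integrand (G (p 0)) · |G′ (p 0)|` on the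
domain, then `[r₀] − [c′] ∈ KZ.relations`: one move `KZ.changeOfVariablesRel` with
`Φ(p) = (G (p 0))`, `Φ′(p) = G′(p 0) • id`, `|det Φ′| = |G′|`.
[cite: KontsevichZagier2001, §1.2 rule (2)] -/
theorem of_sub_of_mem_relations_of_cov_fin_one {G G' : ℝ → ℝ} {I : Set ℝ}
    (r₀ c' : KZ.IntegralRep 1) (hdom : r₀.domain = {p | p 0 ∈ I})
    (hGσ : IsSemialgebraicFunOn ℚ r₀.domain (fun p => G (p 0)))
    (hd : ∀ x ∈ I, HasDerivAt G (G' x) x) (hinj : InjOn G I)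
    (hc'd : c'.domain = {p | p 0 ∈ G '' I})
    (hjac : ∀ p ∈ r₀.domain, r₀.integrand p = c'.integrand (fun _ => G (p 0)) * |G' (p 0)|) :
    KZ.of r₀ - KZ.of c' ∈ KZ.relations := by
  set Φ : (Fin 1 → ℝ) → (Fin 1 → ℝ) := fun p _ => G (p 0) with hΦ
  set Φ' : (Fin 1 → ℝ) → ((Fin 1 → ℝ) →L[ℝ] (Fin 1 → ℝ)) :=
    fun p => G' (p 0) • ContinuousLinearMap.id ℝ (Fin 1 → ℝ) with hΦ'
  refine KZ.changeOfVariablesRel_subset_relations ⟨1, r₀, c', Φ, Φ', ?_, ?_, ?_, ?_, ?_, rfl⟩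
  · exact IsSemialgebraicMapOn.of_forall r₀.isSemialgebraic_domain fun _ => hGσ
  · intro p hp
    rw [hdom] at hp
    exact (hasFDerivAt_fin_one G (G' (p 0)) p (hd (p 0) hp)).hasFDerivWithinAt
  · intro p hp q hq h
    rw [hdom] at hp hq
    have h0 : G (p 0) = G (q 0) := congr_fun h 0
    funext i
    rw [Fin.fin_one_eq_zero i]
    exact hinj hp hq h0
  · rw [hc'd, hdom]
    exact (image_slab_eq rfl).symm
  · intro p hp
    rw [hjac p hp, hΦ', det_smul_id_fin_one]

/-! ### The two kinds of cells -/

/-- **Cells where `G′ ≡ 0`.** If `G` is continuous on `[u, v]` with derivative `G′ = 0` on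
`(u, v)`, then `G v = G u` (mean value theorem). [folklore] -/
theorem dlog_cell_const {u v : ℝ} {G G' : ℝ → ℝ} (huv : u < v)
    (hGc : ContinuousOn G (Icc u v)) (hd : ∀ x ∈ Ioo u v, HasDerivAt G (G' x) x)
    (h0 : ∀ x ∈ Ioo u v, G' x = 0) : G v = G u := by
  obtain ⟨c, hc, hc'⟩ := exists_hasDerivAt_eq_slope G G' huv hGc hd
  rw [h0 c hc, eq_comm, div_eq_zero_iff, sub_eq_zero, sub_eq_zero] at hc'
  rcases hc' with h | h
  · exact h
  · exact absurd h huv.ne'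

/-- **Cells where `G′ ≠ 0`: one change of variables.** For real-algebraic `u < v` with
`[u, v] ⊆ [a, b]`, `G > 0` continuous and `ℚ`-semialgebraic on `[a, b]` with derivative `G′ ≠ 0`
on `(u, v)`, and `r₀ = [(u, v), G′/G]`: `G′` has one sign (Darboux), `G` is strictly monotone on
`[u, v]`, and the move `t = G(x)` (rule (2), Jacobian `|G′|`) gives
`[r₀] − ε • [(α, β), dt/t] ∈ KZ.relations` with `(α, β, ε) = (G u, G v, 1)` if `G′ > 0` and
`(G v, G u, −1)` if `G′ < 0` (through the negative representation `−[(α, β), dt/t]` and integrand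
additivity); in both cases `ε · log (β/α) = log (G v / G u)`, and `G u`, `G v` are algebraic as
values of a `ℚ`-semialgebraic function at algebraic points.
[cite: KontsevichZagier2001, §1.2 rule (2)] -/
theorem dlog_cell_cov :
    ∀ {a b u v : ℝ} {G G' : ℝ → ℝ} (r₀ : Literature.NumberTheory.Transcendental.KZ.IntegralRep 1),
    a ≤ u → u < v → v ≤ b → IsAlgebraic ℚ u → IsAlgebraic ℚ v →
    (∀ x ∈ Set.Icc a b, 0 < G x) → ContinuousOn G (Set.Icc a b) →
    (∀ x ∈ Set.Ioo a b, HasDerivAt G (G' x) x) →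
    IsSemialgebraicFunOn ℚ {t : Fin 1 → ℝ | t 0 ∈ Set.Icc a b} (fun t => G (t 0)) →
    (∀ x ∈ Set.Ioo u v, G' x ≠ 0) →
    r₀.domain = {t | u < t 0 ∧ t 0 < v} →
    Set.EqOn r₀.integrand (fun t => G' (t 0) / G (t 0)) r₀.domain →
    ∃ (α β : ℝ) (ε : ℤ) (c : Literature.NumberTheory.Transcendental.KZ.IntegralRep 1),
      0 < α ∧ α ≤ β ∧ IsAlgebraic ℚ α ∧ IsAlgebraic ℚ β ∧
      c.domain = {t | α < t 0 ∧ t 0 < β} ∧ Set.EqOn c.integrand (fun t => 1 / t 0) c.domain ∧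
      (ε : ℝ) * Real.log (β / α) = Real.log (G v / G u) ∧
      Literature.NumberTheory.Transcendental.KZ.of r₀ -
        ε • Literature.NumberTheory.Transcendental.KZ.of c ∈
        Literature.NumberTheory.Transcendental.KZ.relations := by
  intro a b u v G G' r₀ hau huv hvb hu hv hGpos hGc hd hG hne hdom hint
  have hIcc : Icc u v ⊆ Icc a b := Icc_subset_Icc hau hvb
  have hIoo : Ioo u v ⊆ Ioo a b := Ioo_subset_Ioo hau hvb
  have hGc' : ContinuousOn G (Icc u v) := hGc.mono hIcc
  have hu'' : u ∈ Icc u v := left_mem_Icc.2 huv.le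
  have hv'' : v ∈ Icc u v := right_mem_Icc.2 huv.le
  have hu' : u ∈ Icc a b := hIcc hu''
  have hv' : v ∈ Icc a b := hIcc hv''
  have hGu : 0 < G u := hGpos u hu'
  have hGv : 0 < G v := hGpos v hv'
  have hGu_alg : IsAlgebraic ℚ (G u) := hG.isAlgebraic_apply_one hu' hu
  have hGv_alg : IsAlgebraic ℚ (G v) := hG.isAlgebraic_apply_one hv' hv
  have hd' : ∀ x ∈ Ioo u v, HasDerivAt G (G' x) x := fun x hx => hd x (hIoo hx)
  -- Darboux: `G′` has one sign on the cell
  have hsign : (∀ x ∈ Ioo u v, G' x < 0) ∨ ∀ x ∈ Ioo u v, 0 < G' x :=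
    hasDerivWithinAt_forall_lt_or_forall_gt_of_forall_ne (convex_Ioo u v)
      (fun x hx => (hd' x hx).hasDerivWithinAt) hne
  have hderiv : ∀ x ∈ interior (Icc u v), deriv G x = G' x ∧ x ∈ Ioo u v := fun x hx => by
    rw [interior_Icc] at hx
    exact ⟨(hd' x hx).deriv, hx⟩
  -- data of the move
  have hdom' : r₀.domain = {p | p 0 ∈ Ioo u v} := hdom
  have hGσ : IsSemialgebraicFunOn ℚ r₀.domain (fun p => G (p 0)) := by
    rw [hdom]
    exact hG.mono (fun p hp => ⟨hau.trans hp.1.le, hp.2.le.trans hvb⟩) (isSemialgebraic_logIvl hu hv)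
  have hpos_dom : ∀ p ∈ r₀.domain, 0 < G (p 0) := fun p hp => by
    rw [hdom] at hp
    exact hGpos _ ⟨hau.trans hp.1.le, hp.2.le.trans hvb⟩
  rcases hsign with hneg | hpos
  · -- `G′ < 0`: `G` strictly decreasing, target `−[(G v, G u), dt/t]`
    have hanti : StrictAntiOn G (Icc u v) := strictAntiOn_of_deriv_neg (convex_Icc u v) hGc'
      fun x hx => by rw [(hderiv x hx).1]; exact hneg x (hderiv x hx).2
    obtain ⟨c, hcd, hci⟩ := exists_logRep (b := G u) hGv hGv_alg hGu_alg
    have hcov : KZ.of r₀ - KZ.of c.neg ∈ KZ.relations := by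
      refine of_sub_of_mem_relations_of_cov_fin_one r₀ c.neg hdom' hGσ hd'
        (hanti.injOn.mono Ioo_subset_Icc_self) ?_ fun p hp => ?_
      · rw [KZ.IntegralRep.domain_neg, hcd, image_Ioo_of_strictAntiOn huv.le hGc' hanti]
        rfl
      · have hp' : p 0 ∈ Ioo u v := by rw [hdom] at hp; exact hp
        rw [hint hp, KZ.IntegralRep.integrand_neg, Pi.neg_apply, hci, abs_of_neg (hneg _ hp')]
        have hG0 : G (p 0) ≠ 0 := (hpos_dom p hp).ne'
        field_simp
    have hcneg : KZ.of c + KZ.of c.neg ∈ KZ.relations :=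
      KZ.of_add_of_mem_relations_of_eqOn_neg rfl fun _ _ => rfl
    refine ⟨G v, G u, -1, c, hGv, (hanti hu'' hv'' huv).le, hGv_alg, hGu_alg, hcd,
      fun p _ => by rw [hci], ?_, ?_⟩
    · rw [← inv_div, Real.log_inv]
      push_cast
      ring
    · have e : KZ.of r₀ - (-1 : ℤ) • KZ.of c = (KZ.of r₀ - KZ.of c.neg) + (KZ.of c + KZ.of c.neg) := by
        rw [neg_one_zsmul]
        abel
      rw [e]
      exact KZ.relations.add_mem hcov hcneg
  · -- `G′ > 0`: `G` strictly increasing, target `[(G u, G v), dt/t]`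
    have hmono : StrictMonoOn G (Icc u v) := strictMonoOn_of_deriv_pos (convex_Icc u v) hGc'
      fun x hx => by rw [(hderiv x hx).1]; exact hpos x (hderiv x hx).2
    obtain ⟨c, hcd, hci⟩ := exists_logRep (b := G v) hGu hGu_alg hGv_alg
    have hcov : KZ.of r₀ - KZ.of c ∈ KZ.relations := by
      refine of_sub_of_mem_relations_of_cov_fin_one r₀ c hdom' hGσ hd'
        (hmono.injOn.mono Ioo_subset_Icc_self) ?_ fun p hp => ?_
      · rw [hcd, image_Ioo_of_strictMonoOn huv.le hGc' hmono]
        rfl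
      · have hp' : p 0 ∈ Ioo u v := by rw [hdom] at hp; exact hp
        rw [hint hp, hci, abs_of_pos (hpos _ hp')]
        have hG0 : G (p 0) ≠ 0 := (hpos_dom p hp).ne'
        field_simp
    refine ⟨G u, G v, 1, c, hGu, (hmono hu'' hv'' huv).le, hGu_alg, hGv_alg, hcd,
      fun p _ => by rw [hci], ?_, ?_⟩
    · push_cast
      ring
    · rwa [one_zsmul]

end Summit.KontsevichZagierPeriods.KontsevichZagierPeriods.Cruxes.NeronTorsionSector.Translation

end
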